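import Literature.Analysis.FunctionSpaces.BesselJZeroSeriesRemainder
import Mathlib.Analysis.SpecialFunctions.Trigonometric.Basic
import HarnessLib

/-!
# Format D-K soundness, part 1: rotation and Taylor expansion of trigonometric sums

Cell `rh-explicit`, WEIL TRACK — GRH ARM, route B (weil-grh-3).  Pure real analysis used by the
soundness proof of the kernel checker `DualTrigKernel.lean`: a finite sum
`P(θ) = Σ_t (A_t cos(κ_t θ) + B_t sin(κ_t θ))` is, on a cell `θ = θ_c + φ`, `|φ| ≤ η`,

* ROTATED to the centre: `A cos(κ(θ_c+φ)) + B sin(κ(θ_c+φ)) = U cos(κφ) + V sin(κφ)` with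
  `U = A cos κθ_c + B sin κθ_c`, `V = B cos κθ_c − A sin κθ_c`, `|U|, |V| ≤ |A| + |B|`;
* TAYLOR-EXPANDED to degree `2R − 1` with the Lagrange remainders of the real sine and cosine series
  (`abs_cos_sub_sum_range_le`, `abs_sin_sub_sum_range_le` of the tree):
  `|U cos(κφ) + V sin(κφ) − Σ_{m<2R} s_m W_m κ^m φ^m / m!| ≤ |U|(|κ|η)^{2R}/(2R)! + |V|(|κ|η)^{2R+1}/(2R+1)!`,
  `W_m = U` (`m` even), `V` (`m` odd), `s_m = (−1)^{⌊m/2⌋}`;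
* summed over a list of terms: the polynomial with the MOMENTS `Σ_t W_{t,m} κ_t^m` as coefficients
  approximates `P(θ_c + φ)` within `Σ_t (|A_t|+|B_t|)((|κ_t|η)^{2R}/(2R)! + (|κ_t|η)^{2R+1}/(2R+1)!)`.

Everything here is PROVED; no named facts, no `sorry`.

## References

* DLMF 4.19.1–4.19.2 (sine/cosine series with Lagrange remainder), via the tree's
  `Literature.Analysis.FunctionSpaces.abs_cos_sub_sum_range_le`. [folklore]
-/

noncomputable section

open Finset Real

namespace Summit.Ventures.WeilGRH

namespace DualTrigTaylor

/-! ### One term -/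

/-- A real term `A cos(κθ) + B sin(κθ)`. [folklore] -/
structure RTerm where
  /-- frequency -/
  κ : ℝ
  /-- cosine coefficient -/
  A : ℝ
  /-- sine coefficient -/
  B : ℝ

namespace RTerm

/-- Value at `θ`. [folklore] -/
def val (t : RTerm) (θ : ℝ) : ℝ := t.A * Real.cos (t.κ * θ) + t.B * Real.sin (t.κ * θ)

/-- Rotated cosine coefficient at the centre `θc`. [folklore] -/
def U (t : RTerm) (θc : ℝ) : ℝ := t.A * Real.cos (t.κ * θc) + t.B * Real.sin (t.κ * θc)

/-- Rotated sine coefficient at the centre `θc`. [folklore] -/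
def V (t : RTerm) (θc : ℝ) : ℝ := t.B * Real.cos (t.κ * θc) - t.A * Real.sin (t.κ * θc)

/-- **Rotation**: `val (θc + φ) = U cos(κφ) + V sin(κφ)`. [folklore] -/
theorem val_add (t : RTerm) (θc φ : ℝ) :
    t.val (θc + φ) = t.U θc * Real.cos (t.κ * φ) + t.V θc * Real.sin (t.κ * φ) := by
  simp only [val, U, V, mul_add, Real.cos_add, Real.sin_add]
  ring

/-- `|U| ≤ |A| + |B|`. [folklore] -/
theorem abs_U_le (t : RTerm) (θc : ℝ) : |t.U θc| ≤ |t.A| + |t.B| := by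
  unfold U
  calc |t.A * Real.cos (t.κ * θc) + t.B * Real.sin (t.κ * θc)|
      ≤ |t.A * Real.cos (t.κ * θc)| + |t.B * Real.sin (t.κ * θc)| := abs_add_le _ _
    _ ≤ |t.A| + |t.B| := by
        rw [abs_mul, abs_mul]
        gcongr
        · exact mul_le_of_le_one_right (abs_nonneg _) (Real.abs_cos_le_one _)
        · exact mul_le_of_le_one_right (abs_nonneg _) (Real.abs_sin_le_one _)

/-- `|V| ≤ |A| + |B|`. [folklore] -/
theorem abs_V_le (t : RTerm) (θc : ℝ) : |t.V θc| ≤ |t.A| + |t.B| := by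
  unfold V
  calc |t.B * Real.cos (t.κ * θc) - t.A * Real.sin (t.κ * θc)|
      ≤ |t.B * Real.cos (t.κ * θc)| + |t.A * Real.sin (t.κ * θc)| := abs_sub _ _
    _ ≤ |t.B| + |t.A| := by
        rw [abs_mul, abs_mul]
        gcongr
        · exact mul_le_of_le_one_right (abs_nonneg _) (Real.abs_cos_le_one _)
        · exact mul_le_of_le_one_right (abs_nonneg _) (Real.abs_sin_le_one _)
    _ = |t.A| + |t.B| := add_comm _ _

/-- The `m`-th rotated weight: `U` for even `m`, `V` for odd `m`. [folklore] -/
def W (t : RTerm) (θc : ℝ) (m : ℕ) : ℝ := if m % 2 = 0 then t.U θc else t.V θc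

/-- The sign `(−1)^{⌊m/2⌋}` of the `m`-th Taylor coefficient of `cos`/`sin`. [folklore] -/
def sgn (m : ℕ) : ℝ := (-1) ^ (m / 2)

/-- The `m`-th Taylor coefficient of the rotated term: `s_m W_m κ^m / m!`. [folklore] -/
def coef (t : RTerm) (θc : ℝ) (m : ℕ) : ℝ := sgn m * t.W θc m * t.κ ^ m / (m.factorial : ℝ)

/-- The remainder bound of a term on `|φ| ≤ η` at order `2R`. [folklore] -/
def rem (t : RTerm) (η : ℝ) (R : ℕ) : ℝ :=
  (|t.A| + |t.B|) * ((|t.κ| * η) ^ (2 * R) / ((2 * R).factorial : ℝ) +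
    (|t.κ| * η) ^ (2 * R + 1) / ((2 * R + 1).factorial : ℝ))

/-- Splitting a sum over `range (2R)` into even and odd indices. [folklore] -/
theorem sum_range_two_mul (f : ℕ → ℝ) (R : ℕ) :
    ∑ m ∈ range (2 * R), f m = ∑ l ∈ range R, (f (2 * l) + f (2 * l + 1)) := by
  induction R with
  | zero => simp
  | succ R ih =>
      rw [show 2 * (R + 1) = 2 * R + 1 + 1 by ring, sum_range_succ, sum_range_succ, ih, sum_range_succ]
      ring

/-- The Taylor polynomial of the rotated term equals the cosine and sine partial sums. [folklore] -/
theorem sum_coef_mul_pow (t : RTerm) (θc φ : ℝ) (R : ℕ) :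
    ∑ m ∈ range (2 * R), t.coef θc m * φ ^ m =
      t.U θc * ∑ l ∈ range R, (-1) ^ l * (t.κ * φ) ^ (2 * l) / (2 * l).factorial +
        t.V θc * ∑ l ∈ range R, (-1) ^ l * (t.κ * φ) ^ (2 * l + 1) / (2 * l + 1).factorial := by
  rw [sum_range_two_mul, mul_sum, mul_sum, ← sum_add_distrib]
  refine sum_congr rfl fun l _ ↦ ?_
  have h1 : (2 * l) % 2 = 0 := by omega
  have h2 : (2 * l + 1) % 2 = 1 := by omega
  have h3 : (2 * l) / 2 = l := by omega
  have h4 : (2 * l + 1) / 2 = l := by omega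
  simp only [coef, W, sgn, h1, h2, h3, h4, if_true, one_ne_zero, if_false, mul_pow]
  ring

/-- **Taylor bound for one rotated term**: for `|φ| ≤ η`,
`|val(θc + φ) − Σ_{m<2R} coef_m φ^m| ≤ rem`. [folklore] -/
theorem abs_val_sub_sum_le (t : RTerm) (θc : ℝ) {φ η : ℝ} (hφ : |φ| ≤ η) (R : ℕ) :
    |t.val (θc + φ) - ∑ m ∈ range (2 * R), t.coef θc m * φ ^ m| ≤ t.rem η R := by
  rw [val_add, sum_coef_mul_pow]
  set u := t.κ * φ with hu
  have hc := Literature.Analysis.FunctionSpaces.abs_cos_sub_sum_range_le u R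
  have hs := Literature.Analysis.FunctionSpaces.abs_sin_sub_sum_range_le u R
  have hη : 0 ≤ η := (abs_nonneg φ).trans hφ
  have huη : |u| ≤ |t.κ| * η := by rw [hu, abs_mul]; gcongr
  have e : t.U θc * Real.cos u + t.V θc * Real.sin u -
      (t.U θc * ∑ l ∈ range R, (-1) ^ l * u ^ (2 * l) / (2 * l).factorial +
        t.V θc * ∑ l ∈ range R, (-1) ^ l * u ^ (2 * l + 1) / (2 * l + 1).factorial) =
      t.U θc * (Real.cos u - ∑ l ∈ range R, (-1) ^ l * u ^ (2 * l) / (2 * l).factorial) +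
        t.V θc * (Real.sin u - ∑ l ∈ range R, (-1) ^ l * u ^ (2 * l + 1) / (2 * l + 1).factorial) := by
    ring
  rw [e]
  have hA := t.abs_U_le θc
  have hB := t.abs_V_le θc
  calc |t.U θc * (Real.cos u - ∑ l ∈ range R, (-1) ^ l * u ^ (2 * l) / ↑(2 * l).factorial) +
        t.V θc * (Real.sin u - ∑ l ∈ range R, (-1) ^ l * u ^ (2 * l + 1) / ↑(2 * l + 1).factorial)|
      ≤ |t.U θc| * (|u| ^ (2 * R) / (2 * R).factorial) +
          |t.V θc| * (|u| ^ (2 * R + 1) / (2 * R + 1).factorial) := by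
        refine (abs_add_le _ _).trans (add_le_add ?_ ?_)
        · rw [abs_mul]; exact mul_le_mul_of_nonneg_left hc (abs_nonneg _)
        · rw [abs_mul]; exact mul_le_mul_of_nonneg_left hs (abs_nonneg _)
    _ ≤ (|t.A| + |t.B|) * ((|t.κ| * η) ^ (2 * R) / (2 * R).factorial) +
          (|t.A| + |t.B|) * ((|t.κ| * η) ^ (2 * R + 1) / (2 * R + 1).factorial) := by
        gcongr
    _ = t.rem η R := by rw [rem]; ring

end RTerm

/-! ### A list of terms -/

/-- `P(θ) = Σ_t val_t(θ)`. [folklore] -/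
def sumVal (ts : List RTerm) (θ : ℝ) : ℝ := (ts.map fun t ↦ t.val θ).sum

/-- The `m`-th MOMENT `Σ_t W_{t,m} κ_t^m` at the centre `θc`. [folklore] -/
def moment (ts : List RTerm) (θc : ℝ) (m : ℕ) : ℝ := (ts.map fun t ↦ t.W θc m * t.κ ^ m).sum

/-- The `m`-th Taylor coefficient `s_m · moment_m / m!`. [folklore] -/
def coefSum (ts : List RTerm) (θc : ℝ) (m : ℕ) : ℝ := RTerm.sgn m * moment ts θc m / (m.factorial : ℝ)

/-- Total remainder `Σ_t rem_t`. [folklore] -/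
def remSum (ts : List RTerm) (η : ℝ) (R : ℕ) : ℝ := (ts.map fun t ↦ t.rem η R).sum

/-- [folklore] -/
@[simp] theorem sumVal_nil (θ : ℝ) : sumVal [] θ = 0 := by simp [sumVal]
/-- [folklore] -/
@[simp] theorem sumVal_cons (t : RTerm) (ts : List RTerm) (θ : ℝ) :
    sumVal (t :: ts) θ = t.val θ + sumVal ts θ := by simp [sumVal]
/-- [folklore] -/
@[simp] theorem moment_nil (θc : ℝ) (m : ℕ) : moment [] θc m = 0 := by simp [moment]
/-- [folklore] -/
@[simp] theorem moment_cons (t : RTerm) (ts : List RTerm) (θc : ℝ) (m : ℕ) :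
    moment (t :: ts) θc m = t.W θc m * t.κ ^ m + moment ts θc m := by simp [moment]
/-- [folklore] -/
@[simp] theorem remSum_nil (η : ℝ) (R : ℕ) : remSum [] η R = 0 := by simp [remSum]
/-- [folklore] -/
@[simp] theorem remSum_cons (t : RTerm) (ts : List RTerm) (η : ℝ) (R : ℕ) :
    remSum (t :: ts) η R = t.rem η R + remSum ts η R := by simp [remSum]

/-- `coefSum` is additive over the list. [folklore] -/
theorem coefSum_cons (t : RTerm) (ts : List RTerm) (θc : ℝ) (m : ℕ) :
    coefSum (t :: ts) θc m = t.coef θc m + coefSum ts θc m := by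
  simp only [coefSum, moment_cons, RTerm.coef]
  ring

/-- [folklore] -/
theorem coefSum_nil (θc : ℝ) (m : ℕ) : coefSum [] θc m = 0 := by simp [coefSum]

/-- **Taylor bound for the sum**: for `|φ| ≤ η`,
`|P(θc + φ) − Σ_{m<2R} coefSum_m φ^m| ≤ Σ_t rem_t`. [folklore] -/
theorem abs_sumVal_sub_sum_le (θc : ℝ) {φ η : ℝ} (hφ : |φ| ≤ η) (R : ℕ) :
    ∀ ts : List RTerm,
      |sumVal ts (θc + φ) - ∑ m ∈ range (2 * R), coefSum ts θc m * φ ^ m| ≤ remSum ts η R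
  | [] => by simp [coefSum_nil]
  | t :: ts => by
      have ih := abs_sumVal_sub_sum_le θc hφ R ts
      have ht := t.abs_val_sub_sum_le θc hφ R
      rw [sumVal_cons, remSum_cons]
      have e : t.val (θc + φ) + sumVal ts (θc + φ) - ∑ m ∈ range (2 * R), coefSum (t :: ts) θc m * φ ^ m =
          (t.val (θc + φ) - ∑ m ∈ range (2 * R), t.coef θc m * φ ^ m) +
            (sumVal ts (θc + φ) - ∑ m ∈ range (2 * R), coefSum ts θc m * φ ^ m) := by
        simp only [coefSum_cons, add_mul, sum_add_distrib]
        ring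
      rw [e]
      exact (abs_add_le _ _).trans (add_le_add ht ih)

/-- One-sided form: `P(θc + φ) ≥ Σ_m coefSum_m φ^m − Σ_t rem_t` for `|φ| ≤ η`. [folklore] -/
theorem sum_sub_remSum_le_sumVal (θc : ℝ) {φ η : ℝ} (hφ : |φ| ≤ η) (R : ℕ) (ts : List RTerm) :
    ∑ m ∈ range (2 * R), coefSum ts θc m * φ ^ m - remSum ts η R ≤ sumVal ts (θc + φ) := by
  have h := abs_sumVal_sub_sum_le θc hφ R ts
  rw [abs_le] at h
  linarith [h.1]

/-- `P` is `2π`-periodic when all frequencies are integers. [folklore] -/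
theorem sumVal_add_two_pi : ∀ ts : List RTerm, (∀ t ∈ ts, ∃ k : ℤ, t.κ = k) →
    ∀ θ : ℝ, sumVal ts (θ + 2 * π) = sumVal ts θ
  | [], _, θ => by simp
  | t :: ts, h, θ => by
      obtain ⟨k, hk⟩ := h t (by simp)
      have ih := sumVal_add_two_pi ts (fun s hs ↦ h s (by simp [hs])) θ
      rw [sumVal_cons, sumVal_cons, ih]
      congr 1
      simp only [RTerm.val, hk, mul_add]
      rw [show (k : ℝ) * (2 * π) = k * (2 * π) by ring, Real.cos_add_int_mul_two_pi,
        Real.sin_add_int_mul_two_pi]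

/-- `P` is even when all sine coefficients vanish. [folklore] -/
theorem sumVal_neg : ∀ ts : List RTerm, (∀ t ∈ ts, t.B = 0) → ∀ θ : ℝ, sumVal ts (-θ) = sumVal ts θ
  | [], _, θ => by simp
  | t :: ts, h, θ => by
      have hB := h t (by simp)
      have ih := sumVal_neg ts (fun s hs ↦ h s (by simp [hs])) θ
      rw [sumVal_cons, sumVal_cons, ih]
      simp [RTerm.val, hB, mul_neg, Real.cos_neg]

/-- A crude bound: `P(θ) ≥ −Σ_t (|A_t| + |B_t|)`. [folklore] -/
theorem neg_sum_abs_le_sumVal : ∀ (ts : List RTerm) (θ : ℝ),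
    -(ts.map fun t ↦ |t.A| + |t.B|).sum ≤ sumVal ts θ
  | [], θ => by simp
  | t :: ts, θ => by
      have ih := neg_sum_abs_le_sumVal ts θ
      rw [sumVal_cons, List.map_cons, List.sum_cons]
      have h1 : -(|t.A| + |t.B|) ≤ t.val θ := by
        have ha : |t.A * Real.cos (t.κ * θ)| ≤ |t.A| := by
          rw [abs_mul]; exact mul_le_of_le_one_right (abs_nonneg _) (Real.abs_cos_le_one _)
        have hb : |t.B * Real.sin (t.κ * θ)| ≤ |t.B| := by
          rw [abs_mul]; exact mul_le_of_le_one_right (abs_nonneg _) (Real.abs_sin_le_one _)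
        rw [abs_le] at ha hb
        simp only [RTerm.val]
        linarith [ha.1, hb.1]
      linarith

end DualTrigTaylor

end Summit.Ventures.WeilGRH

end
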